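import Literature.MathematicalPhysics.QuantumFieldTheory.Balaban1983to89.B7Prop4Flat
import HarnessLib

/-!
# `hP1room` PROGRAMME (LEAD-H g6 «WINDOWS-6», part I of II): ★ WINDOW LETTERS FROM ONE CUBIC SMALLNESS — the common arithmetic core behind the NEW `H42`-top windows of the
# v2 composers (design (D2)): ✓`HalvingHSiteRowsOfSocketsT.siteRows_of_socketsT` (k ≥ 2: `hkb hbudget42 hr42 hr2 hwin42`) and
# ✓`HalvingHSiteRowsOfSocketsBaseT.siteRows_of_sockets_baseT` (k = 1: `hα₂ hkb hbudget42 hr hr2 hwin`), plus the knit-gauge row `hε₁l`, in the schedule letters of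
# ✓`HalvingHSupURhoWindowsRho3.exists_topCall_constants_of_rhoWindow₃` (`α₂ := 2(L·c⋆) + 8α₄`, top-log `ttop := 2·((d·(M′+ρ′)) : ℕ)·ε₁`, member letters `4 < Cr`, `Cr·ε₁ ≤ ε₀`);
# part II (`…HalvingHSiteH42WindowsOfHw`) adds the exponential read-radius windows and assembles the two displayed tuples

Route `UnitScaleTilt`, crux K1 child «MinimiserStabilityRegPr» (stmt-QuantumFields-19200), registered stub `stub_halvingStep` (`BirthV10`); cell `ym3-torus` (HUMAN RULING
D-0037: YM₃ on T³ is ladder rung R3 — NOT d = 4, NOT a mass gap, NOT the Clay problem), twin-width seat `ym-ust-19936-w8` gen 4.  `--supports stmt-QuantumFields-19200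
--as helper`; THEOREMS ONLY (0 `def`, 0 `sorry`); count-neutral; nothing here claims `core′`, `hMember(L)`, `hSockets`, the stub, the crux or the gap.

WHAT.  Hypotheses (all at the packs' call sites, d = 3 substituted): the schedule's DEFINING EQUATIONS ((0) of ✓`exists_topCall_constants_of_rhoWindow₃` with `α₀ := ε₀`;
the packs hold them after their `obtain` as `e0 ∕ hα₁def ∕ hcB2 ∕ eB ∕ hα₄B2`): `m₀ = 3(M′+ρ′)+1`, `α₁ = 198s′ + 27s′∕(LB₀)` (`s′ := (ρ′+M′+1)ε₀`), `c⋆ = 5·3·LB₀(ε₀+α₁)`,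
`B₀' = 300·L·m₀·(B₀'H + 15L²BG·BR + 3BG·BR·B₂')`, `α₄ = 8B₀'(5·3·LB₀)(ε₀+α₁)`; the socket signs; the member letters `4 < Cr`, `0 ≤ ε₁`, `Cr·ε₁ ≤ ε₀`; and ONE cubic
smallness in the (K-final) `hw` product shape `10²⁹·L¹²·(1+B₀+B₀⁻¹)²·((1+B₀'H)(1+B₂')(1+BG)(1+BR))⁵·Z·((ρ′+M′+1)³ε₀) ≤ 1` with a GENERIC factor `Z ≥ 1` (part II takes
`Z := 1 + cB9⁻¹`, the (K-final) `hw` verbatim, at the base and `Z := 1 + B₀'H⁻¹` at the step).  ★`windowLetters_of_hw` then gives: signs, `α₄ = 8B₀'c⋆`, the floor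
`300·L·B₀'H ≤ B₀'`, `405s′ ≤ c⋆`, the sizes `c⋆, L·c⋆, α₄, c⋆·Z ≤ 10⁻²⁰`, `hkb` (`c4 3 = 1∕160768`), `hbudget42`, the top-log window
`2·(3(M′+ρ′))·ε₁ + (C2 3 + 64·60800·(5L)²)·α₂² < 2·3·L·α₁` (`ttop ≤ (3∕2)s′`, `(…)α₂² ≤ s′∕40`, `6Lα₁ ≥ 1188s′`) and `hε₁l : 2·(3(M′+ρ′))·ε₁ ≤ 1`.  Route:
`c⋆ ≤ 3390·L·X₀·N·ε₀` (`X₀ := 1+B₀+B₀⁻¹`, `N := ρ′+M′+1`), `B₀' ≤ 17100·L³·N·Y` (`Y :=` the four-factor product), `α₄ ≤ 5·10⁸·L⁴X₀YN²ε₀`, `α₂ ≤ 5·10⁹·L⁴X₀YN²ε₀`, and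
monomial domination by the unit `q := L¹²X₀²Y⁵ZN³ε₀ ≤ 10⁻²⁹` (★`mono_le`).  Arithmetic only ([folklore]); the read-radius comparison
`e^{2a}((e^{x} − 1) + v) ≤ (1 + 3a)(x + x² + v)` (★`readRadius_le`, from Mathlib `Real.abs_exp_sub_one_sub_id_le`) is the §0 letter part II uses for `hr ∕ hr2`.
HONEST SCOPE.  Window bookkeeping; nothing of [Balaban1985RegularSpaces] Prop. 5 ∕ Sect. E ∕ Theorem 4, `core′` or the stub is proved here.

References: T. Bałaban, CMP **99** (1985) 75–102 [Balaban1985RegularSpaces] (Prop. 3 (1.36)–(1.42) pp.82–83, Thm 4 p.88, Prop. 5 (1.106) p.94); CMP **98** (1985) 17–51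
[Balaban1985Averaging] ((54) p.26, (127)–(135) p.39, (203)–(214) pp.49–50).
-/

set_option autoImplicit false

noncomputable section

namespace Summit.QuantumFields.YangMills.Theorems.HalvingHSiteH42WindowLetters

open Literature.MathematicalPhysics.QuantumFieldTheory.Balaban1983to89
open B7Prop3Flat (C1)
open B7Prop4Flat (C2 c4)

/-! ## §0 Elementary letters -/

/-- `e^{2a} ≤ 1 + 3a` for `0 ≤ a ≤ 1∕4` (from Mathlib `Real.abs_exp_sub_one_sub_id_le`: `e^{x} ≤ 1 + x + x²` on `|x| ≤ 1`). [folklore] -/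
theorem exp_two_mul_le {a : ℝ} (h0 : 0 ≤ a) (h1 : a ≤ 1 / 4) : Real.exp (2 * a) ≤ 1 + 3 * a := by
  have h := Real.abs_exp_sub_one_sub_id_le (x := 2 * a) (by rw [abs_of_nonneg (by linarith only [h0])]; linarith only [h1])
  have h' := (abs_le.mp h).2
  have hsq : (2 * a) ^ 2 ≤ 1 * a := by
    calc (2 * a) ^ 2 = (4 * a) * a := by ring
      _ ≤ 1 * a := mul_le_mul_of_nonneg_right (by linarith only [h1]) h0
  linarith only [h', hsq]

/-- The read-radius comparison `e^{2a}·((e^{x} − 1) + v) ≤ (1 + 3a)·(x + x² + v)` for `0 ≤ x ≤ 1`, `0 ≤ a ≤ 1∕4`, `0 ≤ v`. [folklore] -/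
theorem readRadius_le {x a v : ℝ} (hx0 : 0 ≤ x) (hx1 : x ≤ 1) (ha0 : 0 ≤ a) (ha1 : a ≤ 1 / 4) (hv : 0 ≤ v) :
    Real.exp (2 * a) * ((Real.exp x - 1) + v) ≤ (1 + 3 * a) * (x + x ^ 2 + v) := by
  have h := Real.abs_exp_sub_one_sub_id_le (x := x) (by rw [abs_of_nonneg hx0]; exact hx1)
  have h1 : (Real.exp x - 1) + v ≤ x + x ^ 2 + v := by linarith only [(abs_le.mp h).2]
  have hsum0 : 0 ≤ x + x ^ 2 + v := by positivity
  calc Real.exp (2 * a) * ((Real.exp x - 1) + v) ≤ Real.exp (2 * a) * (x + x ^ 2 + v) :=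
        mul_le_mul_of_nonneg_left h1 (Real.exp_pos _).le
    _ ≤ (1 + 3 * a) * (x + x ^ 2 + v) := mul_le_mul_of_nonneg_right (exp_two_mul_le ha0 ha1) hsum0

/-- Monomial domination: `Lᵃ·Xᵇ·Yᶜ·Zᵉ·Nᶠ·ε ≤ L¹²·X²·Y⁵·Z·N³·ε` for exponents below `(12, 2, 5, 1, 3)`, bases `≥ 1` and `ε ≥ 0`. [folklore] -/
theorem mono_le {L X Y Z N ε : ℝ} (hL : 1 ≤ L) (hX : 1 ≤ X) (hY : 1 ≤ Y) (hZ : 1 ≤ Z) (hN : 1 ≤ N) (hε : 0 ≤ ε)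
    {a b c e f : ℕ} (ha : a ≤ 12) (hb : b ≤ 2) (hc : c ≤ 5) (he : e ≤ 1) (hf : f ≤ 3) :
    L ^ a * X ^ b * Y ^ c * Z ^ e * N ^ f * ε ≤ L ^ 12 * X ^ 2 * Y ^ 5 * Z * N ^ 3 * ε := by
  have h1 : L ^ a ≤ L ^ 12 := pow_le_pow_right₀ hL ha
  have h2 : X ^ b ≤ X ^ 2 := pow_le_pow_right₀ hX hb
  have h3 : Y ^ c ≤ Y ^ 5 := pow_le_pow_right₀ hY hc
  have h4 : Z ^ e ≤ Z := by
    calc Z ^ e ≤ Z ^ 1 := pow_le_pow_right₀ hZ he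
      _ = Z := pow_one Z
  have h5 : N ^ f ≤ N ^ 3 := pow_le_pow_right₀ hN hf
  have hL0 : 0 ≤ L := by linarith only [hL]
  have hX0 : 0 ≤ X := by linarith only [hX]
  have hY0 : 0 ≤ Y := by linarith only [hY]
  have hZ0 : 0 ≤ Z := by linarith only [hZ]
  have hN0 : 0 ≤ N := by linarith only [hN]
  have hXb : 0 ≤ X ^ b := pow_nonneg hX0 b
  have hYc : 0 ≤ Y ^ c := pow_nonneg hY0 c
  have hZe : 0 ≤ Z ^ e := pow_nonneg hZ0 e
  have hNf : 0 ≤ N ^ f := pow_nonneg hN0 f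
  have hL12 : 0 ≤ L ^ 12 := pow_nonneg hL0 12
  have hX2 : 0 ≤ X ^ 2 := pow_nonneg hX0 2
  have hY5 : 0 ≤ Y ^ 5 := pow_nonneg hY0 5
  have hN3 : 0 ≤ N ^ 3 := pow_nonneg hN0 3
  exact mul_le_mul (mul_le_mul (mul_le_mul (mul_le_mul (mul_le_mul h1 h2 hXb hL12) h3 hYc (mul_nonneg hL12 hX2)) h4 hZe
    (mul_nonneg (mul_nonneg hL12 hX2) hY5)) h5 hNf (mul_nonneg (mul_nonneg (mul_nonneg hL12 hX2) hY5) hZ0)) le_rfl hε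
    (mul_nonneg (mul_nonneg (mul_nonneg (mul_nonneg hL12 hX2) hY5) hZ0) hN3)

/-- `c4 3 = 1∕160768` and `C2 3 = 160768` ([Balaban1985Averaging] (131)–(133): `C₂ = 8C₁`, `c₄ = 1∕(8C₁)`, `C₁(d) = 1256(d+1)²`). [folklore] -/
theorem c4_three : c4 3 = 1 / 160768 ∧ C2 3 = 160768 := by
  constructor
  · simp only [c4, C1]; norm_num
  · simp only [C2, C1]; norm_num

/-! ## §1 The common arithmetic core (d = 3; generic factor `Z ≥ 1` in the smallness) -/

set_option maxHeartbeats 400000 in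
/-- ★ **WINDOW LETTERS FROM THE CUBIC SMALLNESS** (d = 3, generic `Z ≥ 1`): signs, `α₄ = 8B₀'c⋆`, the floor `300·L·B₀'H ≤ B₀'`, `405·s′ ≤ c⋆`, the sizes
`c⋆, L·c⋆, α₄, c⋆·Z ≤ 10⁻²⁰`, then `hkb`, `hbudget42`, the top-log window at `ttop := 2·(3(M′+ρ′))·ε₁` and `hε₁l` — see the module docstring.
[cite: Balaban1985RegularSpaces, Prop. 3 (1.36)-(1.42) pp.82-83, Thm 4 p.88; Balaban1985Averaging, (54) p.26, (127)-(135) p.39, (203)-(214) pp.49-50] -/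
theorem windowLetters_of_hw (L : ℕ) (hL : 2 ≤ L) (M' ρ' : ℕ) {m₀ : ℕ} {ε₀ ε₁ Cr B₀ B₀'H B₂' BG BR α₁ cstar B₀' α₄ Z : ℝ}
    (hε₀ : 0 < ε₀) (hB₀ : 0 < B₀) (hB₀'H : 0 < B₀'H) (hB₂' : 0 ≤ B₂') (hBG : 0 ≤ BG) (hBR : 0 ≤ BR) (hZ1 : 1 ≤ Z)
    (hm₀ : m₀ = 3 * (M' + ρ') + 1)
    (hα₁ : α₁ = 198 * (((ρ' : ℝ) + M' + 1) * ε₀) + 27 * (((ρ' : ℝ) + M' + 1) * ε₀) / ((L : ℝ) * B₀))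
    (hcs : cstar = 5 * ((3 : ℕ) : ℝ) * L * B₀ * (ε₀ + α₁))
    (hB₀' : B₀' = 300 * (L : ℝ) * m₀ * (B₀'H + 15 * (L : ℝ) ^ 2 * BG * BR + 3 * BG * BR * B₂'))
    (hα₄ : α₄ = 8 * B₀' * (5 * ((3 : ℕ) : ℝ) * L * B₀) * (ε₀ + α₁))
    (hCr : 4 < Cr) (hε₁ : 0 ≤ ε₁) (hCrε : Cr * ε₁ ≤ ε₀)
    (hw : (10 : ℝ) ^ 29 * (L : ℝ) ^ 12 * (1 + B₀ + B₀⁻¹) ^ 2 * ((1 + B₀'H) * (1 + B₂') * (1 + BG) * (1 + BR)) ^ 5 * Z *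
      (((ρ' : ℝ) + M' + 1) ^ 3 * ε₀) ≤ 1) :
    0 ≤ cstar ∧ 0 ≤ α₄ ∧ α₄ = 8 * B₀' * cstar ∧ 300 * (L : ℝ) * B₀'H ≤ B₀' ∧ 405 * (((ρ' : ℝ) + M' + 1) * ε₀) ≤ cstar ∧
    cstar ≤ 1 / 10 ^ 20 ∧ (L : ℝ) * cstar ≤ 1 / 10 ^ 20 ∧ α₄ ≤ 1 / 10 ^ 20 ∧ cstar * Z ≤ 1 / 10 ^ 20 ∧
    (2 * (L * cstar) + 8 * α₄) ≤ c4 3 ∧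
    243200 * ((((3 + 2) * L : ℕ) : ℝ)) ^ 2 * (2 * (L * cstar) + 8 * α₄) ≤ 1 ∧
    2 * ((((3 * (M' + ρ')) : ℕ)) : ℝ) * ε₁ + (C2 3 + 64 * 60800 * ((((3 + 2) * L : ℕ) : ℝ)) ^ 2) * (2 * (L * cstar) + 8 * α₄) ^ 2 <
      2 * ((3 : ℕ) : ℝ) * L * α₁ ∧
    2 * ((((3 * (M' + ρ')) : ℕ)) : ℝ) * ε₁ ≤ 1 := by
  obtain ⟨hc4, hC2⟩ := c4_three
  -- opaque letters `ℓ N X₀ Y q` (no `set`: `ring`∕`positivity` must not see through them)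
  obtain ⟨ℓ, hℓ⟩ : ∃ ℓ : ℝ, ℓ = (L : ℝ) := ⟨_, rfl⟩
  rw [← hℓ] at hα₁ hcs hB₀' hα₄ hw ⊢
  have hℓ2 : (2 : ℝ) ≤ ℓ := by rw [hℓ]; exact_mod_cast hL
  have hℓ1 : (1 : ℝ) ≤ ℓ := by linarith only [hℓ2]
  have hℓ0 : (0 : ℝ) < ℓ := by linarith only [hℓ2]
  have hℓne : ℓ ≠ 0 := hℓ0.ne'
  have hB0ne : B₀ ≠ 0 := hB₀.ne'
  obtain ⟨N, hN⟩ : ∃ N : ℝ, N = (ρ' : ℝ) + M' + 1 := ⟨_, rfl⟩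
  rw [← hN] at hα₁ hw ⊢
  have hρ0 : (0 : ℝ) ≤ ρ' := Nat.cast_nonneg _
  have hM0 : (0 : ℝ) ≤ M' := Nat.cast_nonneg _
  have hN1 : 1 ≤ N := by rw [hN]; linarith only [hρ0, hM0]
  have hN0 : 0 ≤ N := by linarith only [hN1]
  obtain ⟨X₀, hX₀⟩ : ∃ X₀ : ℝ, X₀ = 1 + B₀ + B₀⁻¹ := ⟨_, rfl⟩
  obtain ⟨Y, hY⟩ : ∃ Y : ℝ, Y = (1 + B₀'H) * (1 + B₂') * (1 + BG) * (1 + BR) := ⟨_, rfl⟩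
  rw [← hX₀, ← hY] at hw
  have hBi : 0 < B₀⁻¹ := inv_pos.2 hB₀
  have hX1 : 1 ≤ X₀ := by rw [hX₀]; linarith only [hB₀.le, hBi.le]
  have hXB : B₀ ≤ X₀ := by rw [hX₀]; linarith only [hBi.le]
  have hX0' : 0 ≤ X₀ := by linarith only [hX1]
  have hZ0 : 0 ≤ Z := by linarith only [hZ1]
  have hf1 : (1 : ℝ) ≤ 1 + B₀'H := by linarith only [hB₀'H.le]
  have hf2 : (1 : ℝ) ≤ 1 + B₂' := by linarith only [hB₂']
  have hf3 : (1 : ℝ) ≤ 1 + BG := by linarith only [hBG]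
  have hf4 : (1 : ℝ) ≤ 1 + BR := by linarith only [hBR]
  have hf10 : (0 : ℝ) ≤ 1 + B₀'H := by linarith only [hf1]
  have hf20 : (0 : ℝ) ≤ 1 + B₂' := by linarith only [hf2]
  have hf30 : (0 : ℝ) ≤ 1 + BG := by linarith only [hf3]
  -- `Y ≥ 1`, `Y ≥ B₀'H`, `Y ≥ BG·BR`, `Y ≥ BG·BR·B₂'` (each = a product of four factors dominated termwise)
  have hP : ∀ a b c e : ℝ, 0 ≤ b → 0 ≤ c → 0 ≤ e → a ≤ 1 + B₀'H → b ≤ 1 + B₂' → c ≤ 1 + BG → e ≤ 1 + BR →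
      a * b * c * e ≤ Y := by
    intro a b c e hb hc he h1 h2 h3 h4
    rw [hY]
    exact mul_le_mul (mul_le_mul (mul_le_mul h1 h2 hb hf10) h3 hc (mul_nonneg hf10 hf20)) h4 he
      (mul_nonneg (mul_nonneg hf10 hf20) hf30)
  have hY1 : 1 ≤ Y := by
    have h := hP 1 1 1 1 zero_le_one zero_le_one zero_le_one hf1 hf2 hf3 hf4
    have e : (1 : ℝ) * 1 * 1 * 1 = 1 := by ring
    linarith only [h, e]
  have hY0 : 0 ≤ Y := by linarith only [hY1]
  have hYH : B₀'H ≤ Y := by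
    have h := hP B₀'H 1 1 1 zero_le_one zero_le_one zero_le_one (by linarith only) hf2 hf3 hf4
    have e : B₀'H * 1 * 1 * 1 = B₀'H := by ring
    linarith only [h, e]
  have hYGR : BG * BR ≤ Y := by
    have h := hP 1 1 BG BR zero_le_one hBG hBR hf1 hf2 (by linarith only) (by linarith only)
    have e : (1 : ℝ) * 1 * BG * BR = BG * BR := by ring
    linarith only [h, e]
  have hYGR2 : BG * BR * B₂' ≤ Y := by
    have h := hP 1 B₂' BG BR hB₂' hBG hBR hf1 (by linarith only) (by linarith only) (by linarith only)
    have e : (1 : ℝ) * B₂' * BG * BR = BG * BR * B₂' := by ring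
    linarith only [h, e]
  -- the bracket of `B₀'` is `≤ 19·ℓ²·Y`
  have hℓsq : 1 ≤ ℓ ^ 2 := one_le_pow₀ hℓ1
  have hbr : B₀'H + 15 * ℓ ^ 2 * BG * BR + 3 * BG * BR * B₂' ≤ 19 * ℓ ^ 2 * Y := by
    have h2' : ℓ ^ 2 * (BG * BR) ≤ ℓ ^ 2 * Y := mul_le_mul_of_nonneg_left hYGR (by positivity)
    have hYℓ : Y ≤ ℓ ^ 2 * Y := le_mul_of_one_le_left hY0 hℓsq
    linarith only [hYH, h2', hYGR2, hYℓ]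
  have hbr0 : 0 ≤ B₀'H + 15 * ℓ ^ 2 * BG * BR + 3 * BG * BR * B₂' := by positivity
  -- the unit `q := ℓ¹²X₀²Y⁵ZN³ε₀`, `10²⁹ q ≤ 1`
  obtain ⟨q, hq⟩ : ∃ q : ℝ, q = ℓ ^ 12 * X₀ ^ 2 * Y ^ 5 * Z * N ^ 3 * ε₀ := ⟨_, rfl⟩
  have hq0 : 0 ≤ q := by rw [hq]; positivity
  have hq1 : (10 : ℝ) ^ 29 * q ≤ 1 := by
    have e : (10 : ℝ) ^ 29 * q = (10 : ℝ) ^ 29 * ℓ ^ 12 * X₀ ^ 2 * Y ^ 5 * Z * (N ^ 3 * ε₀) := by rw [hq]; ring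
    rw [e]; exact hw
  have hmono : ∀ {a b c e f : ℕ}, a ≤ 12 → b ≤ 2 → c ≤ 5 → e ≤ 1 → f ≤ 3 →
      ℓ ^ a * X₀ ^ b * Y ^ c * Z ^ e * N ^ f * ε₀ ≤ q :=
    fun ha hb hc he hf => hq ▸ mono_le hℓ1 hX1 hY1 hZ1 hN1 hε₀.le ha hb hc he hf
  -- `c⋆ = 15ℓB₀ε₀ + 2970ℓB₀(Nε₀) + 405(Nε₀)`, `405(Nε₀) ≤ c⋆ ≤ 3390·ℓX₀Nε₀`
  have hcs' : cstar = 15 * ℓ * B₀ * ε₀ + 2970 * ℓ * B₀ * (N * ε₀) + 405 * (N * ε₀) := by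
    rw [hcs, hα₁]
    push_cast
    field_simp
    ring
  have hu0 : 0 ≤ ℓ * X₀ * N * ε₀ := by positivity
  have hcsU : cstar ≤ 3390 * (ℓ * X₀ * N * ε₀) := by
    have h1 : ℓ * B₀ * ε₀ ≤ ℓ * X₀ * N * ε₀ := by
      calc ℓ * B₀ * ε₀ = ℓ * B₀ * 1 * ε₀ := by ring
        _ ≤ ℓ * X₀ * N * ε₀ :=
          mul_le_mul_of_nonneg_right (mul_le_mul (mul_le_mul_of_nonneg_left hXB hℓ0.le) hN1 zero_le_one (by positivity)) hε₀.le
    have h2 : ℓ * B₀ * (N * ε₀) ≤ ℓ * X₀ * N * ε₀ := by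
      calc ℓ * B₀ * (N * ε₀) = ℓ * B₀ * N * ε₀ := by ring
        _ ≤ ℓ * X₀ * N * ε₀ :=
          mul_le_mul_of_nonneg_right (mul_le_mul_of_nonneg_right (mul_le_mul_of_nonneg_left hXB hℓ0.le) hN0) hε₀.le
    have h3 : N * ε₀ ≤ ℓ * X₀ * N * ε₀ := by
      calc N * ε₀ = 1 * 1 * N * ε₀ := by ring
        _ ≤ ℓ * X₀ * N * ε₀ :=
          mul_le_mul_of_nonneg_right (mul_le_mul_of_nonneg_right (mul_le_mul hℓ1 hX1 zero_le_one hℓ0.le) hN0) hε₀.le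
    rw [hcs']; linarith only [h1, h2, h3]
  have hcs0 : 0 ≤ cstar := by rw [hcs']; positivity
  have hcsL : 405 * (N * ε₀) ≤ cstar := by
    have h1 : 0 ≤ 15 * ℓ * B₀ * ε₀ + 2970 * ℓ * B₀ * (N * ε₀) := by positivity
    rw [hcs']; linarith only [h1]
  -- `m₀ ≤ 3N`, `1 ≤ m₀`, `300ℓB₀'H ≤ B₀' ≤ 17100 ℓ³ N Y`
  have hm₀R : (m₀ : ℝ) ≤ 3 * N := by
    have e : (m₀ : ℝ) = 3 * ((M' : ℝ) + ρ') + 1 := by rw [hm₀]; push_cast; ring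
    rw [e, hN]; linarith only [hρ0, hM0]
  have hm₀1 : (1 : ℝ) ≤ m₀ := by
    have : 1 ≤ m₀ := by rw [hm₀]; omega
    exact_mod_cast this
  have hB₀'U : B₀' ≤ 17100 * (ℓ ^ 3 * N * Y) := by
    have h1 : 300 * ℓ * (m₀ : ℝ) * (B₀'H + 15 * ℓ ^ 2 * BG * BR + 3 * BG * BR * B₂') ≤ 300 * ℓ * (3 * N) * (19 * ℓ ^ 2 * Y) :=
      mul_le_mul (mul_le_mul_of_nonneg_left hm₀R (by positivity)) hbr hbr0 (by positivity)
    rw [hB₀']; linarith only [h1]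
  have hB₀'L : 300 * ℓ * B₀'H ≤ B₀' := by
    have h1 : B₀'H ≤ B₀'H + 15 * ℓ ^ 2 * BG * BR + 3 * BG * BR * B₂' := by
      have : 0 ≤ 15 * ℓ ^ 2 * BG * BR + 3 * BG * BR * B₂' := by positivity
      linarith only [this]
    have h2 : 300 * ℓ * 1 * B₀'H ≤ 300 * ℓ * (m₀ : ℝ) * (B₀'H + 15 * ℓ ^ 2 * BG * BR + 3 * BG * BR * B₂') :=
      mul_le_mul (mul_le_mul_of_nonneg_left hm₀1 (by positivity)) h1 hB₀'H.le (by positivity)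
    rw [hB₀']; linarith only [h2]
  -- `α₄ = 8 B₀' c⋆ ≤ 5·10⁸ ℓ⁴X₀YN²ε₀`, `α₂ ≤ 5·10⁹ ℓ⁴X₀YN²ε₀ ≤ 5·10⁹ q`
  have hα₄' : α₄ = 8 * B₀' * cstar := by rw [hα₄, hcs]; ring
  have hα₄0 : 0 ≤ α₄ := by
    rw [hα₄']
    have : 0 ≤ B₀' := le_trans (by positivity) hB₀'L
    positivity
  have hv0 : 0 ≤ ℓ ^ 4 * X₀ * Y * N ^ 2 * ε₀ := by positivity
  have hα₄U : α₄ ≤ 5 * 10 ^ 8 * (ℓ ^ 4 * X₀ * Y * N ^ 2 * ε₀) := by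
    have h1 : 8 * B₀' * cstar ≤ 8 * (17100 * (ℓ ^ 3 * N * Y)) * (3390 * (ℓ * X₀ * N * ε₀)) :=
      mul_le_mul (mul_le_mul_of_nonneg_left hB₀'U (by norm_num)) hcsU hcs0 (by positivity)
    rw [hα₄']; linarith only [h1, hv0]
  have hcsU' : ℓ * cstar ≤ 3390 * (ℓ ^ 4 * X₀ * Y * N ^ 2 * ε₀) := by
    have h1 : ℓ * cstar ≤ ℓ * (3390 * (ℓ * X₀ * N * ε₀)) := mul_le_mul_of_nonneg_left hcsU hℓ0.le
    have ha : ℓ ^ 2 ≤ ℓ ^ 4 := pow_le_pow_right₀ hℓ1 (by norm_num)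
    have hNN : N ≤ N ^ 2 := by
      calc N = N * 1 := (mul_one N).symm
        _ ≤ N * N := mul_le_mul_of_nonneg_left hN1 hN0
        _ = N ^ 2 := (sq N).symm
    have h2 : (ℓ ^ 2 * 1 * N) * (X₀ * ε₀) ≤ (ℓ ^ 4 * Y * N ^ 2) * (X₀ * ε₀) :=
      mul_le_mul_of_nonneg_right (mul_le_mul (mul_le_mul ha hY1 zero_le_one (by positivity)) hNN hN0 (by positivity))
        (by positivity)
    have e1 : ℓ * (ℓ * X₀ * N * ε₀) = (ℓ ^ 2 * 1 * N) * (X₀ * ε₀) := by ring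
    have e2 : (ℓ ^ 4 * Y * N ^ 2) * (X₀ * ε₀) = ℓ ^ 4 * X₀ * Y * N ^ 2 * ε₀ := by ring
    linarith only [h1, h2, e1, e2]
  have hα₂U : 2 * (ℓ * cstar) + 8 * α₄ ≤ 5 * 10 ^ 9 * (ℓ ^ 4 * X₀ * Y * N ^ 2 * ε₀) := by linarith only [hcsU', hα₄U, hv0]
  have hα₂0 : 0 ≤ 2 * (ℓ * cstar) + 8 * α₄ := by positivity
  have hvq : ℓ ^ 4 * X₀ * Y * N ^ 2 * ε₀ ≤ q := by
    have h := hmono (a := 4) (b := 1) (c := 1) (e := 0) (f := 2) (by norm_num) (by norm_num) (by norm_num) (by norm_num) (by norm_num)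
    have e : ℓ ^ 4 * X₀ ^ 1 * Y ^ 1 * Z ^ 0 * N ^ 2 * ε₀ = ℓ ^ 4 * X₀ * Y * N ^ 2 * ε₀ := by ring
    linarith only [h, e]
  have hα₂q : 2 * (ℓ * cstar) + 8 * α₄ ≤ 5 * 10 ^ 9 * q := by linarith only [hα₂U, hvq]
  -- `hkb`, `hbudget42`
  have hkb : 2 * (ℓ * cstar) + 8 * α₄ ≤ c4 3 := by
    rw [hc4]; linarith only [hα₂q, hq1]
  have hcast : ((((3 + 2) * L : ℕ)) : ℝ) = 5 * ℓ := by rw [hℓ]; push_cast; ring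
  have hbud : 243200 * ((((3 + 2) * L : ℕ) : ℝ)) ^ 2 * (2 * (ℓ * cstar) + 8 * α₄) ≤ 1 := by
    rw [hcast]
    have h1 : 243200 * (5 * ℓ) ^ 2 * (2 * (ℓ * cstar) + 8 * α₄) ≤ 243200 * (5 * ℓ) ^ 2 * (5 * 10 ^ 9 * (ℓ ^ 4 * X₀ * Y * N ^ 2 * ε₀)) :=
      mul_le_mul_of_nonneg_left hα₂U (by positivity)
    have h3 : ℓ ^ 6 * X₀ ^ 1 * Y ^ 1 * Z ^ 0 * N ^ 2 * ε₀ ≤ q := hmono (by norm_num) (by norm_num) (by norm_num) (by norm_num) (by norm_num)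
    have e : 243200 * (5 * ℓ) ^ 2 * (5 * 10 ^ 9 * (ℓ ^ 4 * X₀ * Y * N ^ 2 * ε₀)) =
        30400000000000000 * (ℓ ^ 6 * X₀ ^ 1 * Y ^ 1 * Z ^ 0 * N ^ 2 * ε₀) := by ring
    linarith only [h1, h3, e, hq1]
  -- sizes: `c⋆, ℓc⋆, α₄, c⋆Z ≤ 10⁻²⁰`
  have hmq : ℓ * X₀ * N * ε₀ ≤ q := by
    have h := hmono (a := 1) (b := 1) (c := 0) (e := 0) (f := 1) (by norm_num) (by norm_num) (by norm_num) (by norm_num) (by norm_num)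
    have e : ℓ ^ 1 * X₀ ^ 1 * Y ^ 0 * Z ^ 0 * N ^ 1 * ε₀ = ℓ * X₀ * N * ε₀ := by ring
    linarith only [h, e]
  have hcsS : cstar ≤ 1 / 10 ^ 20 := by
    have : cstar * 10 ^ 20 ≤ 1 := by linarith only [hcsU, hmq, hq1, hq0]
    rwa [le_div_iff₀ (by positivity)]
  have hℓcsS : ℓ * cstar ≤ 1 / 10 ^ 20 := by
    have : ℓ * cstar * 10 ^ 20 ≤ 1 := by linarith only [hcsU', hvq, hq1, hq0]
    rwa [le_div_iff₀ (by positivity)]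
  have hα₄S : α₄ ≤ 1 / 10 ^ 20 := by
    have : α₄ * 10 ^ 20 ≤ 1 := by linarith only [hα₄U, hvq, hq1, hq0]
    rwa [le_div_iff₀ (by positivity)]
  have hcsZ : cstar * Z ≤ 1 / 10 ^ 20 := by
    have h1 : cstar * Z ≤ 3390 * (ℓ * X₀ * N * ε₀) * Z := mul_le_mul_of_nonneg_right hcsU hZ0
    have h2 : ℓ ^ 1 * X₀ ^ 1 * Y ^ 0 * Z ^ 1 * N ^ 1 * ε₀ ≤ q := hmono (by norm_num) (by norm_num) (by norm_num) (by norm_num) (by norm_num)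
    have e : 3390 * (ℓ * X₀ * N * ε₀) * Z = 3390 * (ℓ ^ 1 * X₀ ^ 1 * Y ^ 0 * Z ^ 1 * N ^ 1 * ε₀) := by ring
    have : cstar * Z * 10 ^ 20 ≤ 1 := by linarith only [h1, h2, e, hq1, hq0]
    rwa [le_div_iff₀ (by positivity)]
  -- the top-log window at `ttop := 2·(3(M′+ρ′))·ε₁`, and `hε₁l`
  have hε₁U : 4 * ε₁ ≤ ε₀ := by
    have : 4 * ε₁ ≤ Cr * ε₁ := mul_le_mul_of_nonneg_right hCr.le hε₁
    linarith only [this, hCrε]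
  have hMN : ((M' : ℝ) + ρ') ≤ N := by rw [hN]; linarith only
  have hNe0 : 0 ≤ N * ε₀ := by positivity
  have hNe : 0 < N * ε₀ := by positivity
  have httop : 2 * ((((3 * (M' + ρ')) : ℕ)) : ℝ) * ε₁ ≤ 3 / 2 * (N * ε₀) := by
    have h1 : ((M' : ℝ) + ρ') * (4 * ε₁) ≤ N * ε₀ := mul_le_mul hMN hε₁U (by positivity) hN0
    have e : 2 * ((((3 * (M' + ρ')) : ℕ)) : ℝ) * ε₁ = 3 / 2 * (((M' : ℝ) + ρ') * (4 * ε₁)) := by push_cast; ring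
    rw [e]; linarith only [h1]
  have hα₁L : 198 * (N * ε₀) ≤ α₁ := by
    have : 0 ≤ 27 * (N * ε₀) / (ℓ * B₀) := by positivity
    rw [hα₁]; linarith only [this]
  have hsq : (C2 3 + 64 * 60800 * ((((3 + 2) * L : ℕ) : ℝ)) ^ 2) * (2 * (ℓ * cstar) + 8 * α₄) ^ 2 ≤ 1 / 40 * (N * ε₀) := by
    rw [hC2, hcast]
    have hC : (160768 : ℝ) + 64 * 60800 * (5 * ℓ) ^ 2 ≤ 10 ^ 8 * ℓ ^ 2 := by linarith only [hℓsq]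
    have hsq1 : (2 * (ℓ * cstar) + 8 * α₄) ^ 2 ≤ (5 * 10 ^ 9 * (ℓ ^ 4 * X₀ * Y * N ^ 2 * ε₀)) ^ 2 :=
      pow_le_pow_left₀ hα₂0 hα₂U 2
    have hm3 : ℓ ^ 10 * X₀ ^ 2 * Y ^ 2 * Z ^ 0 * N ^ 3 * ε₀ ≤ q := hmono (by norm_num) (by norm_num) (by norm_num) (by norm_num) (by norm_num)
    have h1 : (160768 + 64 * 60800 * (5 * ℓ) ^ 2) * (2 * (ℓ * cstar) + 8 * α₄) ^ 2 ≤
        (10 ^ 8 * ℓ ^ 2) * (5 * 10 ^ 9 * (ℓ ^ 4 * X₀ * Y * N ^ 2 * ε₀)) ^ 2 :=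
      mul_le_mul hC hsq1 (by positivity) (by positivity)
    have e : (10 ^ 8 * ℓ ^ 2) * (5 * 10 ^ 9 * (ℓ ^ 4 * X₀ * Y * N ^ 2 * ε₀)) ^ 2 =
        25 * 10 ^ 26 * ((ℓ ^ 10 * X₀ ^ 2 * Y ^ 2 * Z ^ 0 * N ^ 3 * ε₀) * (N * ε₀)) := by ring
    have h3 : (ℓ ^ 10 * X₀ ^ 2 * Y ^ 2 * Z ^ 0 * N ^ 3 * ε₀) * (N * ε₀) ≤ q * (N * ε₀) := mul_le_mul_of_nonneg_right hm3 hNe0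
    have h4 : 25 * 10 ^ 26 * (q * (N * ε₀)) ≤ 1 / 40 * (N * ε₀) := by
      have h5 : 25 * 10 ^ 26 * q ≤ 1 / 40 := by linarith only [hq1, hq0]
      calc 25 * 10 ^ 26 * (q * (N * ε₀)) = (25 * 10 ^ 26 * q) * (N * ε₀) := by ring
        _ ≤ 1 / 40 * (N * ε₀) := mul_le_mul_of_nonneg_right h5 hNe0
    linarith only [h1, e, h3, h4]
  have hwin : 2 * ((((3 * (M' + ρ')) : ℕ)) : ℝ) * ε₁ + (C2 3 + 64 * 60800 * ((((3 + 2) * L : ℕ) : ℝ)) ^ 2) * (2 * (ℓ * cstar) + 8 * α₄) ^ 2 <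
      2 * ((3 : ℕ) : ℝ) * ℓ * α₁ := by
    have h1 : 1 * (198 * (N * ε₀)) ≤ ℓ * α₁ := mul_le_mul hℓ1 hα₁L (by positivity) hℓ0.le
    have e : 2 * ((3 : ℕ) : ℝ) * ℓ * α₁ = 6 * (ℓ * α₁) := by push_cast; ring
    rw [e]; linarith only [httop, hsq, h1, hNe]
  have hε₁l : 2 * ((((3 * (M' + ρ')) : ℕ)) : ℝ) * ε₁ ≤ 1 := by
    have h : N * ε₀ ≤ q := by
      have h' := hmono (a := 0) (b := 0) (c := 0) (e := 0) (f := 1) (by norm_num) (by norm_num) (by norm_num) (by norm_num) (by norm_num)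
      have e : ℓ ^ 0 * X₀ ^ 0 * Y ^ 0 * Z ^ 0 * N ^ 1 * ε₀ = N * ε₀ := by ring
      linarith only [h', e]
    linarith only [httop, h, hq1, hq0]
  exact ⟨hcs0, hα₄0, hα₄', hB₀'L, hcsL, hcsS, hℓcsS, hα₄S, hcsZ, hkb, hbud, hwin, hε₁l⟩

end Summit.QuantumFields.YangMills.Theorems.HalvingHSiteH42WindowLetters

end
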